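import Mathlib
import HarnessLib

/-!
# `ContinuumLegGivenGap` (stmt-QuantumFields-15828), line `Sketch`: the duality SELECTION RULE (card FACT 1)

Support file for the crux item stmt-QuantumFields-15828, line `Sketch` = card
`duality-selection-nlo-skewness`. The card's lever (FACT 1): off the origin the free Euclidean curvature
propagator `⟨F_{μν}(x) F_{ρσ}(0)⟩ ∝ -(δ_{νσ}∂_μ∂_ρ - δ_{νρ}∂_μ∂_σ - δ_{μσ}∂_ν∂_ρ + δ_{μρ}∂_ν∂_σ)|x|⁻²` is
built from the Hessian `H = ∂∂|x|⁻²`, which is symmetric and TRACELESS (`|x|⁻²` is harmonic on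
`ℝ⁴ ∖ 0`); the two-form operator induced by a symmetric traceless `H` ANTICOMMUTES with the Hodge star
(it maps self-dual to anti-self-dual two-forms), hence every odd cycle of such operators has zero trace —
the tree-level three-point function of the six-plane action density (the Clay species `r.curvature`)
vanishes identically, so its `IsNonGaussian` witness is an order-`g²` (NLO) effect (`stub_skewWindow`).

Def-free statements over `Matrix (Fin 4) (Fin 4) ℝ` / `Matrix (Fin 6) (Fin 6) ℝ` (two-form labels
`01, 02, 03, 12, 13, 23` = `Fin 6`, first index `![0,0,0,1,1,2]`, second index `![1,2,3,2,3,3]`):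
* `trace_mul_mul_eq_zero_of_anticomm` — `S² = 1` and `S Kᵢ = -Kᵢ S` (i = 1, 2, 3) ⇒ `tr (K₁ K₂ K₃) = 0`;
* `stub_hodgeSelection` (registered sub-goal) — for symmetric traceless `H`, the induced two-form operator
  anticommutes with the Hodge star;
* `trace_twoForm_triple_eq_zero` — odd (triple) cycles of induced operators of symmetric traceless
  Hessians have zero trace;
* `hessian_invNormSq_trace_eq_zero` — the explicit Hessian of `|x|⁻²` on `ℝ⁴` is traceless off `0`.

Pure finite-dimensional algebra (Mathlib only). [folklore]
-/

namespace Summit.QuantumFields.YangMills.Theorems.ContinuumLegGivenGap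

open Matrix

/-- **Odd cycles vanish abstractly**: if `S * S = 1` and `S` anticommutes with `K₁, K₂, K₃`, then
`trace (K₁ * K₂ * K₃) = 0` (insert `S²`, move one `S` around the cycle by cyclicity, pick up `(-1)³`).
[folklore] -/
theorem trace_mul_mul_eq_zero_of_anticomm {n : ℕ} (S K₁ K₂ K₃ : Matrix (Fin n) (Fin n) ℝ)
    (hS : S * S = 1) (h₁ : S * K₁ = -(K₁ * S)) (h₂ : S * K₂ = -(K₂ * S)) (h₃ : S * K₃ = -(K₃ * S)) :
    Matrix.trace (K₁ * K₂ * K₃) = 0 := by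
  have hcyc : Matrix.trace (K₁ * K₂ * K₃) = Matrix.trace (S * K₁ * K₂ * K₃ * S) := by
    calc Matrix.trace (K₁ * K₂ * K₃) = Matrix.trace (S * S * (K₁ * K₂ * K₃)) := by rw [hS, Matrix.one_mul]
      _ = Matrix.trace (S * (S * K₁ * K₂ * K₃)) := by simp only [Matrix.mul_assoc]
      _ = Matrix.trace (S * K₁ * K₂ * K₃ * S) := Matrix.trace_mul_comm _ _
  have hmove : S * K₁ * K₂ * K₃ * S = -(K₁ * K₂ * K₃) := by
    calc S * K₁ * K₂ * K₃ * S = -(K₁ * S) * K₂ * K₃ * S := by rw [h₁]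
      _ = -(K₁ * (S * K₂) * K₃ * S) := by simp only [Matrix.neg_mul, Matrix.mul_assoc]
      _ = K₁ * (K₂ * S) * K₃ * S := by rw [h₂]; simp only [Matrix.mul_neg, Matrix.neg_mul, neg_neg]
      _ = K₁ * K₂ * (S * K₃) * S := by simp only [Matrix.mul_assoc]
      _ = -(K₁ * K₂ * (K₃ * S) * S) := by rw [h₃]; simp only [Matrix.mul_neg, Matrix.neg_mul]
      _ = -(K₁ * K₂ * K₃ * (S * S)) := by simp only [Matrix.mul_assoc]
      _ = -(K₁ * K₂ * K₃) := by rw [hS, Matrix.mul_one]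
  rw [hmove, Matrix.trace_neg] at hcyc
  linarith

/-- **`stub_hodgeSelection` — the selection rule, operator form** (registered sub-goal of
stmt-QuantumFields-15828, line `Sketch`; card FACT 1): for a symmetric traceless `H : M₄(ℝ)` the induced
operator on two-forms, `K_{(μν),(ρσ)} = -(δ_{νσ}H_{μρ} - δ_{νρ}H_{μσ} - δ_{μσ}H_{νρ} + δ_{μρ}H_{νσ})` on the
labels `01,02,03,12,13,23`, ANTICOMMUTES with the Hodge star `⋆` (`(⋆F)₀₁ = F₂₃`, `(⋆F)₀₂ = -F₁₃`,
`(⋆F)₀₃ = F₁₂`): `⋆ K = -K ⋆` — `K` is bipartite between self-dual and anti-self-dual two-forms. [folklore] -/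
theorem stub_hodgeSelection :
    ∀ H : Matrix (Fin 4) (Fin 4) ℝ, H.IsSymm → Matrix.trace H = 0 →
      (!![0, 0, 0, 0, 0, 1; 0, 0, 0, 0, -1, 0; 0, 0, 0, 1, 0, 0; 0, 0, 1, 0, 0, 0; 0, -1, 0, 0, 0, 0;
          1, 0, 0, 0, 0, 0] : Matrix (Fin 6) (Fin 6) ℝ) *
        Matrix.of (fun A B : Fin 6 =>
          -((if (![1, 2, 3, 2, 3, 3] : Fin 6 → Fin 4) A = (![1, 2, 3, 2, 3, 3] : Fin 6 → Fin 4) B then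
              H ((![0, 0, 0, 1, 1, 2] : Fin 6 → Fin 4) A) ((![0, 0, 0, 1, 1, 2] : Fin 6 → Fin 4) B) else 0) -
            (if (![1, 2, 3, 2, 3, 3] : Fin 6 → Fin 4) A = (![0, 0, 0, 1, 1, 2] : Fin 6 → Fin 4) B then
              H ((![0, 0, 0, 1, 1, 2] : Fin 6 → Fin 4) A) ((![1, 2, 3, 2, 3, 3] : Fin 6 → Fin 4) B) else 0) -
            (if (![0, 0, 0, 1, 1, 2] : Fin 6 → Fin 4) A = (![1, 2, 3, 2, 3, 3] : Fin 6 → Fin 4) B then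
              H ((![1, 2, 3, 2, 3, 3] : Fin 6 → Fin 4) A) ((![0, 0, 0, 1, 1, 2] : Fin 6 → Fin 4) B) else 0) +
            (if (![0, 0, 0, 1, 1, 2] : Fin 6 → Fin 4) A = (![0, 0, 0, 1, 1, 2] : Fin 6 → Fin 4) B then
              H ((![1, 2, 3, 2, 3, 3] : Fin 6 → Fin 4) A) ((![1, 2, 3, 2, 3, 3] : Fin 6 → Fin 4) B) else 0))) =
      -(Matrix.of (fun A B : Fin 6 =>
          -((if (![1, 2, 3, 2, 3, 3] : Fin 6 → Fin 4) A = (![1, 2, 3, 2, 3, 3] : Fin 6 → Fin 4) B then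
              H ((![0, 0, 0, 1, 1, 2] : Fin 6 → Fin 4) A) ((![0, 0, 0, 1, 1, 2] : Fin 6 → Fin 4) B) else 0) -
            (if (![1, 2, 3, 2, 3, 3] : Fin 6 → Fin 4) A = (![0, 0, 0, 1, 1, 2] : Fin 6 → Fin 4) B then
              H ((![0, 0, 0, 1, 1, 2] : Fin 6 → Fin 4) A) ((![1, 2, 3, 2, 3, 3] : Fin 6 → Fin 4) B) else 0) -
            (if (![0, 0, 0, 1, 1, 2] : Fin 6 → Fin 4) A = (![1, 2, 3, 2, 3, 3] : Fin 6 → Fin 4) B then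
              H ((![1, 2, 3, 2, 3, 3] : Fin 6 → Fin 4) A) ((![0, 0, 0, 1, 1, 2] : Fin 6 → Fin 4) B) else 0) +
            (if (![0, 0, 0, 1, 1, 2] : Fin 6 → Fin 4) A = (![0, 0, 0, 1, 1, 2] : Fin 6 → Fin 4) B then
              H ((![1, 2, 3, 2, 3, 3] : Fin 6 → Fin 4) A) ((![1, 2, 3, 2, 3, 3] : Fin 6 → Fin 4) B) else 0))) *
        (!![0, 0, 0, 0, 0, 1; 0, 0, 0, 0, -1, 0; 0, 0, 0, 1, 0, 0; 0, 0, 1, 0, 0, 0; 0, -1, 0, 0, 0, 0;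
          1, 0, 0, 0, 0, 0] : Matrix (Fin 6) (Fin 6) ℝ)) := by
  intro H hH htr
  have hs : ∀ i j : Fin 4, H i j = H j i := fun i j => by
    simpa using congrFun (congrFun hH j) i
  have ht : H 0 0 + H 1 1 + H 2 2 + H 3 3 = 0 := by
    simpa [Matrix.trace, Fin.sum_univ_four] using htr
  ext A B
  fin_cases A <;> fin_cases B <;>
    simp [Matrix.mul_apply, Fin.sum_univ_succ, Matrix.of_apply] <;>
    linarith [hs 0 1, hs 0 2, hs 0 3, hs 1 2, hs 1 3, hs 2 3, ht]

/-- The Hodge star on two-forms of `ℝ⁴` (labels `01,02,03,12,13,23`) is an involution: `⋆ ⋆ = 1`. [folklore] -/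
theorem hodgeStar_mul_self :
    (!![0, 0, 0, 0, 0, 1; 0, 0, 0, 0, -1, 0; 0, 0, 0, 1, 0, 0; 0, 0, 1, 0, 0, 0; 0, -1, 0, 0, 0, 0;
          1, 0, 0, 0, 0, 0] : Matrix (Fin 6) (Fin 6) ℝ) * (!![0, 0, 0, 0, 0, 1; 0, 0, 0, 0, -1, 0; 0, 0, 0, 1, 0, 0; 0, 0, 1, 0, 0, 0; 0, -1, 0, 0, 0, 0;
          1, 0, 0, 0, 0, 0] : Matrix (Fin 6) (Fin 6) ℝ) = 1 := by
  ext A B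
  fin_cases A <;> fin_cases B <;> simp [Matrix.mul_apply, Fin.sum_univ_succ]

/-- **Odd Wick cycles vanish** (card FACT 1, trace form): for three symmetric traceless `Hᵢ : M₄(ℝ)` (in
the line: the Hessians `∂∂|·|⁻²` at the three displacements of a triangle), the triangle of induced
two-form operators has zero trace — `⋆` anticommutes with each (`stub_hodgeSelection`) and `⋆⋆ = 1`
(`trace_mul_mul_eq_zero_of_anticomm`). Hence the tree-level three-point function of the six-plane action
density of free glue vanishes at non-coincident points. [folklore] -/
theorem trace_twoForm_triple_eq_zero :
    let K : Matrix (Fin 4) (Fin 4) ℝ → Matrix (Fin 6) (Fin 6) ℝ := fun H =>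
      Matrix.of (fun A B : Fin 6 =>
          -((if (![1, 2, 3, 2, 3, 3] : Fin 6 → Fin 4) A = (![1, 2, 3, 2, 3, 3] : Fin 6 → Fin 4) B then
              H ((![0, 0, 0, 1, 1, 2] : Fin 6 → Fin 4) A) ((![0, 0, 0, 1, 1, 2] : Fin 6 → Fin 4) B) else 0) -
            (if (![1, 2, 3, 2, 3, 3] : Fin 6 → Fin 4) A = (![0, 0, 0, 1, 1, 2] : Fin 6 → Fin 4) B then
              H ((![0, 0, 0, 1, 1, 2] : Fin 6 → Fin 4) A) ((![1, 2, 3, 2, 3, 3] : Fin 6 → Fin 4) B) else 0) -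
            (if (![0, 0, 0, 1, 1, 2] : Fin 6 → Fin 4) A = (![1, 2, 3, 2, 3, 3] : Fin 6 → Fin 4) B then
              H ((![1, 2, 3, 2, 3, 3] : Fin 6 → Fin 4) A) ((![0, 0, 0, 1, 1, 2] : Fin 6 → Fin 4) B) else 0) +
            (if (![0, 0, 0, 1, 1, 2] : Fin 6 → Fin 4) A = (![0, 0, 0, 1, 1, 2] : Fin 6 → Fin 4) B then
              H ((![1, 2, 3, 2, 3, 3] : Fin 6 → Fin 4) A) ((![1, 2, 3, 2, 3, 3] : Fin 6 → Fin 4) B) else 0)))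
    ∀ H₁ H₂ H₃ : Matrix (Fin 4) (Fin 4) ℝ, H₁.IsSymm → Matrix.trace H₁ = 0 → H₂.IsSymm → Matrix.trace H₂ = 0 →
      H₃.IsSymm → Matrix.trace H₃ = 0 → Matrix.trace (K H₁ * K H₂ * K H₃) = 0 := by
  intro K H₁ H₂ H₃ h₁ t₁ h₂ t₂ h₃ t₃
  exact trace_mul_mul_eq_zero_of_anticomm _ (K H₁) (K H₂) (K H₃) hodgeStar_mul_self
    (stub_hodgeSelection H₁ h₁ t₁) (stub_hodgeSelection H₂ h₂ t₂) (stub_hodgeSelection H₃ h₃ t₃)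

/-- **Harmonicity of `|x|⁻²` on `ℝ⁴ ∖ 0`, Hessian form**: the explicit Hessian
`∂_μ∂_ν |x|⁻² = -2 δ_{μν} |x|⁻⁴ + 8 x_μ x_ν |x|⁻⁶` is symmetric and traceless for `x ≠ 0` (trace
`= -8|x|⁻⁴ + 8|x|²|x|⁻⁶ = 0`). This is what makes the free curvature propagator of `d = 4` Maxwell theory a
two-form operator of the kind covered by `stub_hodgeSelection`. [folklore] -/
theorem hessian_invNormSq_symm_trace (x : EuclideanSpace ℝ (Fin 4)) (hx : x ≠ 0) :
    (Matrix.of fun μ ν : Fin 4 =>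
        -2 * (if μ = ν then (1 : ℝ) else 0) / ‖x‖ ^ 4 + 8 * x μ * x ν / ‖x‖ ^ 6).IsSymm ∧
      Matrix.trace (Matrix.of fun μ ν : Fin 4 =>
        -2 * (if μ = ν then (1 : ℝ) else 0) / ‖x‖ ^ 4 + 8 * x μ * x ν / ‖x‖ ^ 6) = 0 := by
  constructor
  · ext μ ν
    simp only [Matrix.transpose_apply, Matrix.of_apply]
    rw [eq_comm]
    by_cases h : μ = ν
    · subst h; rfl
    · simp [h, Ne.symm h, mul_right_comm]
  · have hn : ‖x‖ ≠ 0 := norm_ne_zero_iff.2 hx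
    have hsq : ‖x‖ ^ 2 = ∑ i, (x i) ^ 2 := EuclideanSpace.real_norm_sq_eq x
    have htr : Matrix.trace (Matrix.of fun μ ν : Fin 4 =>
        -2 * (if μ = ν then (1 : ℝ) else 0) / ‖x‖ ^ 4 + 8 * x μ * x ν / ‖x‖ ^ 6) =
        ∑ μ : Fin 4, (-2 / ‖x‖ ^ 4 + 8 * (x μ) ^ 2 / ‖x‖ ^ 6) := by
      simp only [Matrix.trace, Matrix.diag, Matrix.of_apply, if_true]
      refine Finset.sum_congr rfl fun μ _ => ?_
      ring
    rw [htr, Finset.sum_add_distrib, Finset.sum_const, Finset.card_univ, Fintype.card_fin,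
      ← Finset.sum_div, ← Finset.mul_sum, ← hsq, nsmul_eq_mul]
    have h2 : ‖x‖ ^ 2 ≠ 0 := pow_ne_zero 2 hn
    have key : 8 * ‖x‖ ^ 2 / ‖x‖ ^ 6 = 8 / ‖x‖ ^ 4 := by
      rw [show ‖x‖ ^ 6 = ‖x‖ ^ 2 * ‖x‖ ^ 4 by ring, mul_comm 8 (‖x‖ ^ 2), mul_div_mul_left _ _ h2]
    rw [key]
    push_cast
    ring

end Summit.QuantumFields.YangMills.Theorems.ContinuumLegGivenGap
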